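import Summits.CriticalPhenomena.PercolationContinuityZ3.Theorems.PercNearOneGluingNoHeavyQuantLongTailTripleWideCost
import HarnessLib

/-!
# QUANT lane R8, T-DEC: THE LONG-TAIL TRIPLE HUB BEYOND `3lo`, ROUTE FILE (TWO LOWS) — both low atoms `3lo`, `3lo+K` of the width-3 hub
# `S(γ₁) ∗ S(γ₂) ∗ S(γ₃)` of shape `{lo, lo+K; γ}`, `3lo ≤ K ≤ 7lo/2`, go to the top `3lo+3K` when `T > 6lo+2K` (census-1 gen 33)

builds on p205010 (kernel theorem, internal audit signed; external expert review pending)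

Support file (`--supports stmt-CriticalPhenomena-4575`), QUANT lane seat prim-quant-census-1 (gen 33); memo
`run/shared/lean/prim/quant/prim-quant-census-1/g33/WIDE3-G33.md` §1.  Theorems only, standard axioms, no sorries.  Companion of
`…QuantLongTailTripleWideRoute` (`tripleWide_routeOne`, one low); the SDEC theorem is `…QuantLongTailTripleWideHub`.  For `K > 3lo` the gated mean
`T = aT₀` can exceed `6lo+2K` (near-one gates, `a` near 1); then the atom `3lo+K` is a second positive low.  Both lows are routed to the top (a two-row
flow): the layer-free rate of the row `3lo+K` (`ρ₁ = (T−6lo−2K)/(2K)`) is dominated by that of the row `3lo` (`ρ = (T−6lo)/(3K)`), so with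
`θ = max(y, ρ)` the column load is `≤ θ/(1−θ)·(ν(3lo)+ν(3lo+K))`; capacity `θ(u₀+u₁+u₃) ≤ u₃` by `ltTop_capRho_two` / `ltTop_capTop_two`, torque cost
`(3lo+3K−T)·θ/(1−θ)·(ν(3lo)+ν(3lo+K)) ≤` the budget of the three atoms below `T` by `ltTop_costRho_two` (`θ = ρ`) and `tripleWide_costTopTwo` (`θ = y`).
* **`tripleWide_routeTwo`** — the capacity and torque-cost facts of the two-row flow to the top at one outer gate with `T > 6lo+2K`.
NUMERICS (memo §1, `g33/code/exp1_threebranch.py`, exact rationals; 2 880 two-low instances on 12 shapes): 0 failures.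

HONEST STATUS.  Route bookkeeping; `SiblingStep`, `GluedDominatedMass`, `SDECConvClosed`, `FarTreeRow` OPEN; RATE class (log\*) / honest sentence of
`run/shared/lean/prim/quant/README.md` unchanged.  [this work].  Nothing here is cited as a published result.  The gluing rows served
[cite: KozmaNitzan2024, Conjecture 3 (p. 15)]; product measure [cite: Grimmett1999, §1.3 p. 10].
-/

noncomputable section
open scoped BigOperators

namespace Summit.CriticalPhenomena.PercolationContinuityZ3.Theorems
namespace Quant
namespace LawDec

/-! ### The two-low route of the wide triple hub -/

set_option maxHeartbeats 800000 in
/-- **the route of the wide triple hub at one outer gate, two lows** (`3lo ≤ K ≤ 7lo/2`; `ν` the gated law with masses `a·u₀..a·u₃` at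
`3lo, 3lo+K, 3lo+2K, 3lo+3K`, `y = ax`, `T = a(3lo + K(g₁+g₂+g₃)) > 6lo+2K`, `g₁` the least gate): both lows go to the top `3lo+3K` — the column's
capacity and its torque cost within the budget. [this work] -/
theorem tripleWide_routeTwo (lo K : ℕ) (hloK : lo < K) (hK3 : 3 * lo ≤ K) (hK7 : 2 * K ≤ 7 * lo) (ν : ℕ → ℝ) (y T a g₁ g₂ g₃ x : ℝ)
    (g0 : ∀ h, 0 ≤ ν h) (h12 : g₁ ≤ g₂) (h13 : g₁ ≤ g₃) (hg : (lo : ℝ) ≤ K * g₁) (h21 : g₂ < 1) (h31 : g₃ < 1) (hx0 : 0 < x)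
    (hxg : x * ((lo : ℝ) + K) ≤ lo + K * g₁) (ha0 : 0 < a) (ha1 : a ≤ 1) (hy : y = a * x)
    (hT : T = a * (3 * (lo : ℝ) + K * (g₁ + g₂ + g₃))) (hT62 : 6 * (lo : ℝ) + 2 * K < T)
    (v0 : ν (3 * lo) = a * ((1 - g₁) * (1 - g₂) * (1 - g₃)))
    (v1 : ν (3 * lo + K) = a * (g₁ * (1 - g₂) * (1 - g₃) + g₂ * (1 - g₁) * (1 - g₃) + g₃ * (1 - g₁) * (1 - g₂)))
    (v2 : ν (3 * lo + 2 * K) = a * (g₁ * g₂ * (1 - g₃) + g₁ * g₃ * (1 - g₂) + g₂ * g₃ * (1 - g₁)))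
    (v3 : ν (3 * lo + 3 * K) = a * (g₁ * g₂ * g₃)) :
    freeRate y T (3 * lo) (3 * lo + 3 * K) * ν (3 * lo) + freeRate y T (3 * lo + K) (3 * lo + 3 * K) * ν (3 * lo + K) ≤ ν (3 * lo + 3 * K) ∧
      (((3 * lo + 3 * K : ℕ) : ℝ) - T)
          * (freeRate y T (3 * lo) (3 * lo + 3 * K) * ν (3 * lo) + freeRate y T (3 * lo + K) (3 * lo + 3 * K) * ν (3 * lo + K))
        ≤ ∑ l ∈ Finset.range (3 * lo + 3 * K + 1), (if (1 ≤ l ∧ (l : ℝ) < T) then ν l * (T - l) else 0) := by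
  have hlo1 : 1 ≤ lo := by omega
  have hlo0 : (0 : ℝ) < lo := by exact_mod_cast (show 0 < lo by omega)
  have hK3R : 3 * (lo : ℝ) ≤ K := by exact_mod_cast hK3
  have hK7R : 2 * (K : ℝ) ≤ 7 * lo := by exact_mod_cast hK7
  have hK0 : (0 : ℝ) < K := by linarith
  have hK20 : (0 : ℝ) < 2 * K := by linarith
  have hK30 : (0 : ℝ) < 3 * K := by linarith
  have hg10 : 0 < g₁ := by
    by_contra hc; push Not at hc
    have : (K : ℝ) * g₁ ≤ 0 := mul_nonpos_of_nonneg_of_nonpos hK0.le hc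
    linarith
  have hg11 : g₁ < 1 := lt_of_le_of_lt h12 h21
  have hg2 : 0 ≤ g₂ := le_trans hg10.le h12
  have hg3 : 0 ≤ g₃ := le_trans hg10.le h13
  have hg₂K : (lo : ℝ) ≤ K * g₂ := le_trans hg (mul_le_mul_of_nonneg_left h12 hK0.le)
  have hg₃K : (lo : ℝ) ≤ K * g₃ := le_trans hg (mul_le_mul_of_nonneg_left h13 hK0.le)
  set u0 : ℝ := (1 - g₁) * (1 - g₂) * (1 - g₃) with hu0
  set u1 : ℝ := g₁ * (1 - g₂) * (1 - g₃) + g₂ * (1 - g₁) * (1 - g₃) + g₃ * (1 - g₁) * (1 - g₂) with hu1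
  set u2 : ℝ := g₁ * g₂ * (1 - g₃) + g₁ * g₃ * (1 - g₂) + g₂ * g₃ * (1 - g₁) with hu2
  set u3 : ℝ := g₁ * g₂ * g₃ with hu3
  have hu0p : 0 < u0 := mul_pos (mul_pos (by linarith) (by linarith)) (by linarith)
  have hu1n : 0 ≤ u1 := by rw [hu1]; positivity
  have hu2n : 0 ≤ u2 := by
    rw [hu2]; have := sub_nonneg.2 hg11.le; have := sub_nonneg.2 h21.le; have := sub_nonneg.2 h31.le; positivity
  have hu3n : 0 ≤ u3 := by rw [hu3]; positivity
  set W : ℝ := u0 + u1 with hW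
  have hWp : 0 < W := by linarith
  set T₀ : ℝ := 3 * (lo : ℝ) + K * (g₁ + g₂ + g₃) with hT₀
  have hT0p : 0 < T₀ := by
    have := mul_pos hK0 (by linarith : 0 < g₁ + g₂ + g₃); rw [hT₀]; linarith
  have hTle : T ≤ T₀ := by
    have := mul_le_mul_of_nonneg_right ha1 hT0p.le; rw [hT]; linarith
  have hT0top : T₀ < 3 * (lo : ℝ) + 3 * K := by
    have := mul_lt_mul_of_pos_left (by linarith : g₁ + g₂ + g₃ < 3) hK0; rw [hT₀]; linarith
  have hL2 : 2 * (K : ℝ) ≤ K * (g₁ + g₂ + g₃) - 3 * lo := by rw [hT₀] at hTle; linarith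
  have hx1 : x < 1 := by
    have : (lo : ℝ) + K * g₁ < lo + K := by have := mul_lt_mul_of_pos_left hg11 hK0; linarith
    by_contra hc; push Not at hc
    have : 1 * ((lo : ℝ) + K) ≤ x * (lo + K) := mul_le_mul_of_nonneg_right hc (by linarith)
    linarith
  have hyx : y ≤ x := by rw [hy]; have := mul_le_mul_of_nonneg_right ha1 hx0.le; linarith
  have hy1 : y < 1 := lt_of_le_of_lt hyx hx1
  have hB0 : (0 : ℝ) < (lo : ℝ) + K := by linarith
  -- floor capacity of the top with two lows (`ltTop_capTop_two`)
  have hxu3 : x * (W + u3) ≤ u3 := by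
    have h1 := ltTop_capTop_two (lo : ℝ) K g₁ g₂ g₃ hlo0 hK3R hK7R hg hg₂K hg₃K h12 h13 hg11.le h21.le h31.le hL2
    rw [← hu0, ← hu1, ← hu3, ← hW] at h1
    have h2 : x * ((lo : ℝ) + K) * (W + u3) ≤ ((lo : ℝ) + K * g₁) * (W + u3) :=
      mul_le_mul_of_nonneg_right hxg (add_nonneg hWp.le hu3n)
    have h3 : ((lo : ℝ) + K) * (x * (W + u3)) ≤ ((lo : ℝ) + K) * u3 := by linarith
    exact le_of_mul_le_mul_left h3 hB0
  clear_value u0 u1 u2 u3 W T₀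
  set D : ℝ := T - 6 * (lo : ℝ) with hD
  have hD2 : 2 * (K : ℝ) < D := by rw [hD]; linarith
  have hDle : D ≤ K * (g₁ + g₂ + g₃) - 3 * lo := by have h := hTle; rw [hT₀] at h; rw [hD]; linarith
  have hD3 : D < 3 * K := by linarith
  clear_value D
  -- ρ-capacity of the top with two lows (`ltTop_capRho_two`)
  have hρu3 : D * (W + u3) ≤ 3 * K * u3 := by
    have h1 := ltTop_capRho_two (lo : ℝ) K g₁ g₂ g₃ D hlo0 hK3R hK7R hg hg₂K hg₃K hg11.le h21.le h31.le hD2.le hDle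
    rw [← hu0, ← hu1, ← hu3, ← hW] at h1; exact h1
  -- the budget: the three atoms below `T`
  set F : ℕ → ℝ := fun l => if (1 ≤ l ∧ (l : ℝ) < T) then ν l * (T - l) else 0 with hF
  clear_value F
  have Fnn : ∀ l ∈ Finset.range (3 * lo + 3 * K + 1), 0 ≤ F l := by
    intro l _; rw [hF]; dsimp only; split_ifs with hc
    · exact mul_nonneg (g0 l) (by linarith [hc.2])
    · exact le_rfl
  have Fge : ∀ l : ℕ, 1 ≤ l → ν l * (T - l) ≤ F l := by
    intro l hl; rw [hF]; dsimp only; split_ifs with hc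
    · exact le_rfl
    · have hle : T ≤ (l : ℝ) := by
        by_contra hlt; push Not at hlt; exact hc ⟨hl, hlt⟩
      exact mul_nonpos_of_nonneg_of_nonpos (g0 l) (by linarith)
  have c3lo : ((3 * lo : ℕ) : ℝ) = 3 * (lo : ℝ) := by push_cast; ring
  have cA1 : ((3 * lo + K : ℕ) : ℝ) = 3 * (lo : ℝ) + K := by push_cast; ring
  have cA2 : ((3 * lo + 2 * K : ℕ) : ℝ) = 3 * (lo : ℝ) + 2 * K := by push_cast; ring
  have bud3 : ν (3 * lo) * (T - 3 * (lo : ℝ)) + ν (3 * lo + K) * (T - (3 * (lo : ℝ) + K)) + ν (3 * lo + 2 * K) * (T - (3 * (lo : ℝ) + 2 * K))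
      ≤ ∑ l ∈ Finset.range (3 * lo + 3 * K + 1), F l := by
    have hsub : ({3 * lo, 3 * lo + K, 3 * lo + 2 * K} : Finset ℕ) ⊆ Finset.range (3 * lo + 3 * K + 1) := by
      intro l hl; simp only [Finset.mem_insert, Finset.mem_singleton] at hl; simp only [Finset.mem_range]; omega
    have hs := Finset.sum_le_sum_of_subset_of_nonneg hsub (fun l hl _ => Fnn l hl)
    have e : ∑ l ∈ ({3 * lo, 3 * lo + K, 3 * lo + 2 * K} : Finset ℕ), F l = F (3 * lo) + (F (3 * lo + K) + F (3 * lo + 2 * K)) := by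
      have n1 : 3 * lo ∉ ({3 * lo + K, 3 * lo + 2 * K} : Finset ℕ) := by
        simp only [Finset.mem_insert, Finset.mem_singleton]; omega
      have n2 : 3 * lo + K ∉ ({3 * lo + 2 * K} : Finset ℕ) := by simp only [Finset.mem_singleton]; omega
      rw [Finset.sum_insert n1, Finset.sum_insert n2, Finset.sum_singleton]
    have f0 := Fge (3 * lo) (by omega); rw [c3lo] at f0
    have f1 := Fge (3 * lo + K) (by omega); rw [cA1] at f1
    have f2 := Fge (3 * lo + 2 * K) (by omega); rw [cA2] at f2
    rw [e] at hs; linarith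
  -- the two layer-free rates and their domination
  have ed0 : (((3 * lo + 3 * K : ℕ) : ℝ) - ((3 * lo : ℕ) : ℝ)) = 3 * K := by push_cast; ring
  have eD0 : T - 2 * (((3 * lo : ℕ) : ℝ)) = D := by rw [c3lo]; linear_combination -hD
  have ed1 : (((3 * lo + 3 * K : ℕ) : ℝ) - ((3 * lo + K : ℕ) : ℝ)) = 2 * K := by push_cast; ring
  have eD1 : T - 2 * (((3 * lo + K : ℕ) : ℝ)) = D - 2 * K := by rw [cA1]; linear_combination -hD
  set θ : ℝ := max y (D / (3 * K)) with hθ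
  set θ₁ : ℝ := max y ((D - 2 * K) / (2 * K)) with hθ₁
  have eθ0 : freeRate y T (3 * lo) (3 * lo + 3 * K) = θ / (1 - θ) := by unfold freeRate; rw [ed0, eD0]
  have eθ1 : freeRate y T (3 * lo + K) (3 * lo + 3 * K) = θ₁ / (1 - θ₁) := by unfold freeRate; rw [ed1, eD1]
  have hρ1 : D / (3 * K) < 1 := by rw [div_lt_one hK30]; exact hD3
  have hθlt : θ < 1 := max_lt hy1 hρ1
  have hθ₁le : θ₁ ≤ θ := by
    refine max_le_max le_rfl ?_
    rw [div_le_div_iff₀ hK20 hK30]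
    nlinarith [mul_lt_mul_of_pos_left hD3 hK0]
  have hθ₁lt : θ₁ < 1 := lt_of_le_of_lt hθ₁le hθlt
  have hyθ : y ≤ θ := le_max_left _ _
  have hθ0 : 0 ≤ θ := le_trans (by rw [hy]; exact (mul_pos ha0 hx0).le) hyθ
  have mono : θ₁ / (1 - θ₁) ≤ θ / (1 - θ) := by
    rw [div_le_div_iff₀ (by linarith) (by linarith)]; nlinarith
  have hload : freeRate y T (3 * lo) (3 * lo + 3 * K) * ν (3 * lo) + freeRate y T (3 * lo + K) (3 * lo + 3 * K) * ν (3 * lo + K)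
      ≤ θ / (1 - θ) * (ν (3 * lo) + ν (3 * lo + K)) := by
    rw [eθ0, eθ1, mul_add]
    have := mul_le_mul_of_nonneg_right mono (g0 (3 * lo + K))
    linarith
  -- capacity: `θ·(ν(3lo) + ν(3lo+K) + ν(top)) ≤ ν(top)`
  have hcap : θ * (ν (3 * lo) + ν (3 * lo + K) + ν (3 * lo + 3 * K)) ≤ ν (3 * lo + 3 * K) := by
    rw [v0, v1, v3]
    have eS : a * u0 + a * u1 + a * u3 = a * (W + u3) := by rw [hW]; ring
    rw [eS, hθ, max_mul_of_nonneg _ _ (mul_nonneg ha0.le (add_nonneg hWp.le hu3n))]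
    refine max_le ?_ ?_
    · have h1 : y * (W + u3) ≤ x * (W + u3) := mul_le_mul_of_nonneg_right hyx (add_nonneg hWp.le hu3n)
      have h2 : a * (y * (W + u3)) ≤ a * u3 := mul_le_mul_of_nonneg_left (le_trans h1 hxu3) ha0.le
      linarith
    · rw [div_mul_eq_mul_div, div_le_iff₀ hK30]
      have h3 : a * (D * (W + u3)) ≤ a * (3 * K * u3) := mul_le_mul_of_nonneg_left hρu3 ha0.le
      linarith
  refine ⟨le_trans hload (rate_mul_le_of_theta hθlt hcap (add_nonneg (g0 _) (g0 _))), ?_⟩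
  -- torque cost
  have htop0 : 0 ≤ ((3 * lo + 3 * K : ℕ) : ℝ) - T := by push_cast; linarith
  refine le_trans (mul_le_mul_of_nonneg_left hload htop0) ?_
  refine le_trans ?_ bud3
  refine cost_le_of_theta hθlt ?_
  push_cast
  rw [hθ]
  rcases le_total y (D / (3 * K)) with hle | hle
  · -- `θ = ρ = D/(3K)`: `ltTop_costRho_two`
    rw [max_eq_right hle, v0, v1, v2]
    have h1 := ltTop_costRho_two (lo : ℝ) K g₁ g₂ g₃ D hlo0 hK3R hK7R hg hg₃K hg11.le h21.le h31.le hD2.le hDle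
    rw [← hu0, ← hu1, ← hu2, ← hW] at h1
    have eT1 : T - 3 * (lo : ℝ) = D + 3 * lo := by linear_combination -hD
    have eT2 : T - (3 * (lo : ℝ) + K) = D + 3 * lo - K := by linear_combination -hD
    have eT3 : T - (3 * (lo : ℝ) + 2 * K) = D + 3 * lo - 2 * K := by linear_combination -hD
    have eT4 : 3 * (lo : ℝ) + 3 * K - T = 3 * K - 3 * lo - D := by linear_combination hD
    rw [eT1, eT2, eT3, eT4]
    have e3 : 1 - D / (3 * K) = (3 * K - D) / (3 * K) := by rw [sub_div, div_self hK30.ne']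
    have eS : a * u0 + a * u1 = a * W := by rw [hW]; ring
    rw [eS, e3]
    have eL : (3 * K - 3 * lo - D) * (D / (3 * K)) * (a * W) = (a / (3 * K)) * ((3 * K - 3 * lo - D) * D * W) := by
      simp only [div_eq_mul_inv]; ring
    have eRt : (3 * K - D) / (3 * K) * (a * u0 * (D + 3 * lo) + a * u1 * (D + 3 * lo - K) + a * u2 * (D + 3 * lo - 2 * K))
        = (a / (3 * K)) * ((3 * K - D) * (u0 * (D + 3 * lo) + u1 * (D + 3 * lo - K) + u2 * (D + 3 * lo - 2 * K))) := by
      simp only [div_eq_mul_inv]; ring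
    rw [eL, eRt]
    exact mul_le_mul_of_nonneg_left h1 (div_nonneg ha0.le hK30.le)
  · -- `θ = y`: `tripleWide_costTopTwo`
    rw [max_eq_left hle, v0, v1, v2]
    have hTleRaw : T ≤ 3 * (lo : ℝ) + K * (g₁ + g₂ + g₃) := by have h := hTle; rw [hT₀] at h; exact h
    have hT62' : 6 * (lo : ℝ) + 2 * K ≤ T := hT62.le
    have hΨT := tripleWide_costTopTwo (lo : ℝ) K g₁ g₂ g₃ x T hlo0 hK3R hK7R hg h12 h13 h21 h31 hx0 hxg hT62' hTleRaw
    rw [← hu0, ← hu1, ← hu2, ← hT₀] at hΨT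
    have exT : x * T = y * T₀ := by rw [hy, hT]; ring
    set Bud : ℝ := u0 * (T - 3 * lo) + u1 * (T - (3 * lo + K)) + u2 * (T - (3 * lo + 2 * K)) with hBud
    set R : ℝ := (1 - y) * Bud - (3 * lo + 3 * K - T) * y * (u0 + u1) with hR
    have e : (T₀ - x * T) * Bud - (3 * lo + 3 * K - T) * (x * T) * (u0 + u1) = T₀ * R := by
      rw [hR, exT]; ring
    have hR0 : 0 ≤ T₀ * R := by rw [← e]; exact hΨT
    have h6 : 0 ≤ R := nonneg_of_mul_nonneg_right hR0 hT0p
    have h7 : 0 ≤ a * R := mul_nonneg ha0.le h6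
    rw [hR, hBud] at h7
    linarith [h7]

end LawDec
end Quant
end Summit.CriticalPhenomena.PercolationContinuityZ3.Theorems
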